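import Summits.CriticalPhenomena.CardyFormulaZ2.Theorems.CardyUSTContinuationKirchhoffExtremalLengthG02Dual2
import Summits.CriticalPhenomena.CardyFormulaZ2.Theorems.CardyUSTContinuationKirchhoffExtremalLengthConductanceBound
import Literature.Probability.LatticeModels.SquareTilingModulusLiminf

/-!
# The current out of `A_δ` is the effective conductance (G02 discretisation)

Support file for `KirchhoffExtremalLength` (route CardyUSTContinuation of `CardyFormulaZ2`, item
stmt-CriticalPhenomena-11234), towards the upper half of `G02ModulusConvergence` (`…Defs.lean`):
for the potential `h` of `Ω_δ = discreteDomainGraph Ω δ` (`h = 1` on `A_δ`, `0` on `B_δ`,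
harmonic elsewhere, energy `= 𝒞(A_δ ↔ B_δ; Ω_δ)`), the total current out of `A_δ` equals the
conductance: `Σ_{x ∈ A_δ} div(x) = 𝒞(A_δ ↔ B_δ; Ω_δ)` (summation by parts on the finite vertex
set `meshDomain Ω δ`; transposition of `SquareTiling.sum_divAt_eq_toReal_conductance`).
-/

noncomputable section

namespace Summit.CriticalPhenomena.CardyFormulaZ2.Theorems

namespace KirchhoffSlope

open Set Metric Filter Topology SimpleGraph Finset
open Literature.Probability Literature.Probability.LatticeModels Literature.Probability.Percolation
open Literature.Probability.LatticeModels.SquareTiling (divAt sum_sqIncr_eq_sum_mul_laplacian)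
open Literature.Probability.RandomPlanarGeometry

variable {δ : ℝ}


open Classical in
/-- **The current out of `T_n` equals the conductance.** For the potential `h` of `Ω_n`
(`= 1` on `T_n`, `= 0` on `B_n`, harmonic elsewhere, with `energy = 𝒞(T_n ↔ B_n)`):
`Σ_{x ∈ T_n} div(x) = 𝒞(T_n ↔ B_n)` where `div(x) = Σ_{y ~ x} (h x - h y)` is the current out of
`x` (`divAt_ecur`). [folklore] -/
theorem sum_divAt_eq_toReal_conductance' (R : ConformalRectangle) (hδ : 0 < δ) {h : Site 2 → ℝ}
    (hT : (discreteArc R.carrier δ (R.arc 0)).EqOn h 1) (hB : (discreteArc R.carrier δ (R.arc 2)).EqOn h 0)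
    (hE : networkEnergy (discreteDomainGraph R.carrier δ) 1 h =
      effectiveConductance (discreteDomainGraph R.carrier δ) 1 (discreteArc R.carrier δ (R.arc 0)) (discreteArc R.carrier δ (R.arc 2)))
    (hharm : ∀ x, x ∉ discreteArc R.carrier δ (R.arc 0) → x ∉ discreteArc R.carrier δ (R.arc 2) →
      ∑ y ∈ ((zdGraph 2).neighborFinset x).filter (fun y => (discreteDomainGraph R.carrier δ).Adj x y), (h y - h x) = 0)
    (hfin : (discreteArc R.carrier δ (R.arc 0)).Finite) :
    ∑ x ∈ hfin.toFinset, divAt (ecurH R.carrier δ h) (ecurV R.carrier δ h) (x - 1) =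
      (effectiveConductance (discreteDomainGraph R.carrier δ) 1 (discreteArc R.carrier δ (R.arc 0)) (discreteArc R.carrier δ (R.arc 2))).toReal := by
  haveI : Fintype (discreteDomainGraph R.carrier δ).edgeSet := (edgeSet_discreteDomainGraph_finite R.isBounded hδ).fintype
  set G := discreteDomainGraph R.carrier δ with hG
  set S : Finset (Site 2) := (meshDomain_finite R.isBounded hδ).toFinset with hS
  have hSmem : ∀ x y, G.Adj x y → x ∈ S := fun x y hxy => by
    rw [hS, Set.Finite.mem_toFinset]; exact (discreteDomainGraph_adj_iff.1 hxy).2.1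
  -- the energy as a real sum
  have hEreal : (networkEnergy G 1 h).toReal = ∑ e ∈ G.edgeFinset, sqIncr h e := by
    rw [networkEnergy_eq_sum]
    rw [ENNReal.toReal_sum (fun e _ => ENNReal.mul_ne_top ENNReal.coe_ne_top ENNReal.ofReal_ne_top)]
    refine sum_congr rfl fun e _ => ?_
    simp [ENNReal.toReal_ofReal (sqIncr_nonneg h e)]
  rw [← hE, hEreal, sum_sqIncr_eq_sum_mul_laplacian G S hSmem h]
  -- the inner sums are the lattice Laplacians
  have hinner : ∀ z : Site 2, ∑ w ∈ S, (if G.Adj z w then (h z - h w) else 0) =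
      -∑ y ∈ ((zdGraph 2).neighborFinset z).filter (fun y => G.Adj z y), (h y - h z) := by
    intro z
    rw [sum_filter, ← sum_neg_distrib]
    -- both sides are sums over the `G`-neighbours of `z`
    have h1 : ∑ w ∈ S, (if G.Adj z w then (h z - h w) else 0) = ∑ w ∈ S.filter (fun w => G.Adj z w), (h z - h w) := by
      rw [sum_filter]
    have h2 : ∑ y ∈ (zdGraph 2).neighborFinset z, -(if G.Adj z y then (h y - h z) else 0) =
        ∑ y ∈ ((zdGraph 2).neighborFinset z).filter (fun y => G.Adj z y), (h z - h y) := by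
      rw [sum_filter]
      refine sum_congr rfl fun y _ => ?_
      split_ifs <;> ring
    rw [h1, h2]
    refine sum_congr ?_ fun _ _ => rfl
    ext w
    simp only [mem_filter, SimpleGraph.mem_neighborFinset]
    constructor
    · rintro ⟨-, hw⟩; exact ⟨meshGraph_le_zdGraph _ _ (discreteDomainGraph_le_meshGraph _ _ hw), hw⟩
    · rintro ⟨-, hw⟩; exact ⟨hSmem _ _ hw.symm, hw⟩
  simp_rw [hinner]
  -- split the vertex sum: only `T_n` contributes
  have hTS : hfin.toFinset ⊆ S := fun x hx => by
    rw [Set.Finite.mem_toFinset] at hx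
    rw [hS, Set.Finite.mem_toFinset]; exact hx.1.1
  rw [← sum_subset hTS]
  · refine sum_congr rfl fun x hx => ?_
    rw [Set.Finite.mem_toFinset] at hx
    have hx1 : h x = 1 := hT hx
    rw [divAt_ecur, hx1, one_mul]
  · intro x hxS hxT
    rw [Set.Finite.mem_toFinset] at hxT
    by_cases hxB : x ∈ discreteArc R.carrier δ (R.arc 2)
    · rw [hB hxB]; simp
    · rw [hharm x hxT hxB]; simp

end KirchhoffSlope

end Summit.CriticalPhenomena.CardyFormulaZ2.Theorems
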